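import Mathlib
import HarnessLib
import Summits.NavierStokesRegularity.NavierStokesRegularity.Theorems.CompletionRelayChainPhaseIPseudoStep

/-!
# Route `CompletionRelayChain` — crux `RelayFrontStep` (stmt-NavierStokesRegularity-24850), K-side of `stub_phaseI`,
  work package K3 (vi): the step theorem with a SIGNED a priori box and a HISTORY-DEPENDENT disturbance bound

`…PhaseIPseudoStep` (p618050) confines the pseudo-trajectory by symmetric margins `h·M` and asks the disturbance bound
`|z' − Q(z,z)| ≤ Δ` whenever the curve is in the box AT THAT INSTANT.  The self-integrating checker (`…PhaseIChecker`)
uses the sharper SIGNED test — lower face below `z₀ + h·min(F_lo − Δ, 0)`, upper face above `z₀ + h·max(F_hi + Δ, 0)`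
with `[F_lo, F_hi] ∋ Q(y,y)` on the box, strict inequalities — and its `Δ` is only valid while the curve HAS STAYED in
the box since the start of the step (the tail-forcing premise (T) and the shell-2 energy bound are integrals over the
past).  This file proves that version: `sub_mem_of_hist` (signed mean value with history), `box_bootstrap_hist`
(first-exit argument), and the assembled `abs_pseudo_sub_taylor_le_hist` (same conclusion as `abs_pseudo_sub_taylor_le`,
via the library's rough-enclosure existence theorem, `abs_sub_taylor_le_of_mem_Icc` and `abs_pseudo_sub_sol_le`).
Folklore ODE analysis; MODEL-lattice bookkeeping (rung TL-M3-R64) — nothing here is a statement about the Navier–Stokes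
equations.
-/

noncomputable section

set_option linter.dupNamespace false

namespace Summit.NavierStokesRegularity.NavierStokesRegularity.Cruxes.RelayFrontStep.PhaseI

open Set Filter Topology
open Summit.NavierStokesRegularity.NavierStokesRegularity.Theorems.TaylorModelVector

variable {ι : Type*} [Fintype ι] [DecidableEq ι]

/-! ### Signed mean value with history -/

omit [Fintype ι] [DecidableEq ι] in
/-- If the curve has stayed in the box on `[0,t]` (`t ≤ h`) and, as long as it has stayed in the box, its velocity lies
in `[v_lo, v_hi]` componentwise, then `t·v_lo ≤ f t − f 0 ≤ t·v_hi`. [folklore] -/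
theorem sub_mem_of_hist {f f' : ℝ → ι → ℝ} {h : ℝ}
    (hder : ∀ s ∈ Icc (0:ℝ) h, HasDerivWithinAt f (f' s) (Icc 0 h) s)
    {L U vlo vhi : ι → ℝ}
    (hrate : ∀ s ∈ Icc (0:ℝ) h, (∀ r ∈ Icc (0:ℝ) s, f r ∈ Icc L U) → ∀ c, vlo c ≤ f' s c ∧ f' s c ≤ vhi c)
    {t : ℝ} (ht : t ∈ Icc (0:ℝ) h) (hin : ∀ s ∈ Icc (0:ℝ) t, f s ∈ Icc L U) :
    ∀ c, t * vlo c ≤ f t c - f 0 c ∧ f t c - f 0 c ≤ t * vhi c := by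
  intro c
  have hsub : Icc (0:ℝ) t ⊆ Icc 0 h := Icc_subset_Icc_right ht.2
  set m : ℝ := (vlo c + vhi c) / 2 with hm
  set r : ℝ := (vhi c - vlo c) / 2 with hr
  -- g σ = f σ c − σ·m has |g'| ≤ r on [0,t]
  have hderg : ∀ s ∈ Icc (0:ℝ) t,
      HasDerivWithinAt (fun σ => f σ c - σ * m) (f' s c - m) (Icc 0 t) s := by
    intro s hs
    have h1 : HasDerivWithinAt (fun σ => f σ c) (f' s c) (Icc 0 t) s :=
      ((hasDerivWithinAt_pi.1 (hder s (hsub hs))) c).mono hsub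
    have h2 : HasDerivWithinAt (fun σ : ℝ => σ * m) (1 * m) (Icc 0 t) s :=
      (hasDerivWithinAt_id s _).mul_const m
    have h3 := h1.sub h2
    rw [one_mul] at h3
    exact h3
  have hbound : ∀ s ∈ Icc (0:ℝ) t, ‖f' s c - m‖ ≤ r := by
    intro s hs
    have hhist : ∀ r' ∈ Icc (0:ℝ) s, f r' ∈ Icc L U := fun r' hr' => hin r' ⟨hr'.1, hr'.2.trans hs.2⟩
    obtain ⟨h1, h2⟩ := hrate s (hsub hs) hhist c
    rw [Real.norm_eq_abs, abs_le]; constructor <;> [rw [hm, hr]; rw [hm, hr]] <;> linarith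
  have key := (convex_Icc (0:ℝ) t).norm_image_sub_le_of_norm_hasDerivWithin_le hderg hbound
    (left_mem_Icc.2 ht.1) (right_mem_Icc.2 ht.1)
  simp only [zero_mul, sub_zero] at key
  rw [Real.norm_eq_abs, Real.norm_eq_abs, abs_of_nonneg ht.1] at key
  obtain ⟨k1, k2⟩ := abs_le.1 key
  constructor
  · rw [hm, hr] at k1; nlinarith
  · rw [hm, hr] at k2; nlinarith

/-! ### Continuous induction in a box, signed, with history -/

omit [DecidableEq ι] in
/-- **CONTINUOUS INDUCTION IN A BOX (signed rates, history)**: a curve on `[0,h]` whose velocity lies in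
`[v_lo, v_hi]` componentwise as long as it has stayed in the closed box `[L,U]`, and whose start point satisfies the
STRICT signed margins `L < f 0 + h·min(v_lo,0)`, `f 0 + h·max(v_hi,0) < U`, stays in the box on `[0,h]` and obeys
`t·v_lo ≤ f t − f 0 ≤ t·v_hi`. [folklore] -/
theorem box_bootstrap_hist {f f' : ℝ → ι → ℝ} {h : ℝ}
    (hder : ∀ s ∈ Icc (0:ℝ) h, HasDerivWithinAt f (f' s) (Icc 0 h) s)
    {L U vlo vhi : ι → ℝ}
    (hrate : ∀ s ∈ Icc (0:ℝ) h, (∀ r ∈ Icc (0:ℝ) s, f r ∈ Icc L U) → ∀ c, vlo c ≤ f' s c ∧ f' s c ≤ vhi c)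
    (htest : ∀ c, L c < f 0 c + h * min (vlo c) 0 ∧ f 0 c + h * max (vhi c) 0 < U c) :
    ∀ t ∈ Icc (0:ℝ) h, f t ∈ Icc L U ∧ ∀ c, t * vlo c ≤ f t c - f 0 c ∧ f t c - f 0 c ≤ t * vhi c := by
  have hcont : ∀ s ∈ Icc (0:ℝ) h, ContinuousWithinAt f (Icc 0 h) s :=
    fun s hs => (hder s hs).continuousWithinAt
  suffices hconf : ∀ t ∈ Icc (0:ℝ) h, f t ∈ Icc L U by
    intro t ht
    exact ⟨hconf t ht, sub_mem_of_hist hder hrate ht (fun s hs => hconf s ⟨hs.1, hs.2.trans ht.2⟩)⟩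
  -- the start point is in the box (for `0 ≤ h`)
  have h0 : ∀ hh : 0 ≤ h, f 0 ∈ Icc L U := fun hh =>
    ⟨fun c => by
      have := (htest c).1
      have : h * min (vlo c) 0 ≤ 0 := mul_nonpos_of_nonneg_of_nonpos hh (min_le_right _ _)
      linarith,
     fun c => by
      have := (htest c).2
      have : 0 ≤ h * max (vhi c) 0 := mul_nonneg hh (le_max_right _ _)
      linarith⟩
  by_contra hcon
  push Not at hcon
  set V : Set ℝ := {t | t ∈ Icc (0:ℝ) h ∧ f t ∉ Icc L U} with hV
  obtain ⟨t₁, ht₁, hft₁⟩ := hcon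
  have hVne : V.Nonempty := ⟨t₁, ht₁, hft₁⟩
  have hVbdd : BddBelow V := ⟨0, fun t ht => ht.1.1⟩
  have hh : 0 ≤ h := ht₁.1.trans ht₁.2
  set tstar := sInf V with htstar
  have hts0 : 0 ≤ tstar := le_csInf hVne fun t ht => ht.1.1
  have htsh : tstar ≤ h := (csInf_le hVbdd ⟨ht₁, hft₁⟩).trans ht₁.2
  have htsI : tstar ∈ Icc (0:ℝ) h := ⟨hts0, htsh⟩
  have hbefore : ∀ s ∈ Icc (0:ℝ) h, s < tstar → f s ∈ Icc L U := by
    intro s hs hslt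
    by_contra hnot
    exact absurd (csInf_le hVbdd ⟨hs, hnot⟩) (not_le.2 hslt)
  have hat : f tstar ∈ Icc L U := by
    rcases eq_or_lt_of_le hts0 with h0eq | hpos
    · rw [← h0eq]; exact h0 hh
    · have hsub : Ico (0:ℝ) tstar ⊆ Icc 0 h := fun s hs => ⟨hs.1, hs.2.le.trans htsh⟩
      have hcw : ContinuousWithinAt f (Ico 0 tstar) tstar := (hcont tstar htsI).mono hsub
      have hcl : tstar ∈ closure (Ico (0:ℝ) tstar) := by
        rw [closure_Ico hpos.ne]; exact right_mem_Icc.2 hpos.le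
      have hmem := hcw.mem_closure_image hcl
      have himg : f '' Ico (0:ℝ) tstar ⊆ Icc L U := by
        rintro _ ⟨s, hs, rfl⟩
        exact hbefore s (hsub hs) hs.2
      exact (isClosed_Icc.closure_subset_iff.2 himg) hmem
  have hin : ∀ s ∈ Icc (0:ℝ) tstar, f s ∈ Icc L U := by
    intro s hs
    rcases eq_or_lt_of_le hs.2 with hse | hsl
    · rw [hse]; exact hat
    · exact hbefore s ⟨hs.1, hs.2.trans htsh⟩ hsl
  have hmv := sub_mem_of_hist hder hrate htsI hin
  -- `f tstar` is strictly inside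
  have hstrict : ∀ c, L c < f tstar c ∧ f tstar c < U c := by
    intro c
    obtain ⟨h1, h2⟩ := hmv c
    have h3 := (htest c).1
    have h4 := (htest c).2
    have hlo : h * min (vlo c) 0 ≤ tstar * vlo c := by
      rcases le_or_gt 0 (vlo c) with hv | hv
      · rw [min_eq_right hv, mul_zero]; exact mul_nonneg hts0 hv
      · rw [min_eq_left hv.le]; nlinarith
    have hhi : tstar * vhi c ≤ h * max (vhi c) 0 := by
      rcases le_or_gt 0 (vhi c) with hv | hv
      · rw [max_eq_left hv]; nlinarith
      · rw [max_eq_right hv.le, mul_zero]; exact mul_nonpos_of_nonneg_of_nonpos hts0 hv.le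
    constructor <;> linarith
  have hopen : IsOpen (Set.pi univ fun c => Ioo (L c) (U c)) :=
    isOpen_set_pi finite_univ fun c _ => isOpen_Ioo
  have hmemO : f tstar ∈ Set.pi univ fun c => Ioo (L c) (U c) := fun c _ => hstrict c
  have hnhds : f ⁻¹' (Set.pi univ fun c => Ioo (L c) (U c)) ∈ 𝓝[Icc 0 h] tstar :=
    (hcont tstar htsI) (hopen.mem_nhds hmemO)
  obtain ⟨δ, hδpos, hδ⟩ := Metric.mem_nhdsWithin_iff.1 hnhds
  obtain ⟨v, hvV, hvlt⟩ := exists_lt_of_csInf_lt hVne (show tstar < tstar + δ by linarith)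
  have hvge : tstar ≤ v := csInf_le hVbdd hvV
  have hvball : v ∈ Metric.ball tstar δ := by
    rw [Metric.mem_ball, Real.dist_eq, abs_of_nonneg (by linarith)]; linarith
  have hvin := hδ ⟨hvball, hvV.1⟩
  have : f v ∈ Icc L U := ⟨fun c => (hvin c (mem_univ c)).1.le, fun c => (hvin c (mem_univ c)).2.le⟩
  exact hvV.2 this

/-! ### The assembled step theorem -/

/-- **ONE STEP, SIGNED BOX, HISTORY-DEPENDENT DISTURBANCE.**  `z` is a curve on `[0,h]` with one-sided derivatives;
its disturbance `|z' − Q(z,z)|_c ≤ Δ_c` holds at time `s` whenever it has stayed in the box on `[0,s]`; `Q(y,y) ∈ [F_lo,F_hi]`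
on the box; the signed strict margins hold at `z 0`; `J` bounds the order-`p+1` jet on the box; `Lm ≥ 0` is a Lipschitz
matrix of `y ↦ Q(y,y)` on the box and `b` passes the linear bootstrap.  Then `z` stays in the box on `[0,h]` and
`|z t c − Σ_{k≤p} T(z 0) k c t^k| ≤ J_c t^{p+1} + t·(Lm b + Δ)_c`. [folklore] -/
theorem abs_pseudo_sub_taylor_le_hist (Q : (ι → ℝ) →ₗ[ℝ] (ι → ℝ) →ₗ[ℝ] ι → ℝ)
    {T : (ι → ℝ) → ℕ → ι → ℝ} (hT0 : ∀ x, T x 0 = x)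
    (hTs : ∀ x (k : ℕ) c, ((k : ℝ) + 1) * T x (k + 1) c =
      ∑ i ∈ Finset.range (k + 1), Q (T x i) (T x (k - i)) c)
    {z z' : ℝ → ι → ℝ} {h : ℝ} (hh : 0 ≤ h)
    (hder : ∀ s ∈ Icc (0:ℝ) h, HasDerivWithinAt z (z' s) (Icc 0 h) s)
    {lo hi Δ Flo Fhi : ι → ℝ} (hΔ : ∀ c, 0 ≤ Δ c)
    (hdist : ∀ s ∈ Icc (0:ℝ) h, (∀ r ∈ Icc (0:ℝ) s, z r ∈ Icc lo hi) → ∀ c, |z' s c - Q (z s) (z s) c| ≤ Δ c)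
    (hQ : ∀ y ∈ Icc lo hi, ∀ c, Flo c ≤ Q y y c ∧ Q y y c ≤ Fhi c)
    (htest : ∀ c, lo c < z 0 c + h * min (Flo c - Δ c) 0 ∧ z 0 c + h * max (Fhi c + Δ c) 0 < hi c)
    {p : ℕ} {J : ι → ℝ} (hJ : ∀ y ∈ Icc lo hi, ∀ c, |T y (p + 1) c| ≤ J c)
    {Lm : ι → ι → ℝ} (hLm : ∀ c c', 0 ≤ Lm c c')
    (hLip : ∀ y ∈ Icc lo hi, ∀ y' ∈ Icc lo hi, ∀ c,
      |Q y y c - Q y' y' c| ≤ ∑ c', Lm c c' * |y c' - y' c'|)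
    {b : ι → ℝ} (hpos : ∀ c, 0 < ∑ c', Lm c c' * b c' + Δ c)
    (hb : ∀ c, h * (∑ c', Lm c c' * b c' + Δ c) ≤ b c) :
    ∀ t ∈ Icc (0:ℝ) h, z t ∈ Icc lo hi ∧ ∀ c,
      |z t c - ∑ k ∈ Finset.range (p + 1), T (z 0) k c * t ^ k| ≤
        J c * t ^ (p + 1) + t * (∑ c', Lm c c' * b c' + Δ c) := by
  -- (1) the pseudo-trajectory stays in the box
  have hrate : ∀ s ∈ Icc (0:ℝ) h, (∀ r ∈ Icc (0:ℝ) s, z r ∈ Icc lo hi) →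
      ∀ c, Flo c - Δ c ≤ z' s c ∧ z' s c ≤ Fhi c + Δ c := by
    intro s hs hhist c
    have hzs : z s ∈ Icc lo hi := hhist s ⟨hs.1, le_rfl⟩
    have h1 := abs_le.1 (hdist s hs hhist c)
    have h2 := hQ (z s) hzs c
    constructor <;> linarith [h1.1, h1.2, h2.1, h2.2]
  have hz := box_bootstrap_hist hder hrate htest
  -- (2) the exact solution from `z 0` exists and stays in the box
  have hx₀ : z 0 ∈ Icc lo hi := (hz 0 (left_mem_Icc.2 hh)).1
  have henc : ∀ y ∈ Icc lo hi, ∀ u ∈ Icc (0:ℝ) h, z 0 + u • Q y y ∈ Icc lo hi := by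
    intro y hy u hu
    constructor <;> intro c <;> simp only [Pi.add_apply, Pi.smul_apply, smul_eq_mul]
    · have h1 := (hQ y hy c).1
      have h2 := (htest c).1
      have h3 : h * min (Flo c - Δ c) 0 ≤ u * Q y y c := by
        rcases le_or_gt 0 (Flo c) with hF | hF
        · have : h * min (Flo c - Δ c) 0 ≤ 0 := mul_nonpos_of_nonneg_of_nonpos hh (min_le_right _ _)
          nlinarith [hu.1]
        · have hm : min (Flo c - Δ c) 0 ≤ Flo c - Δ c := min_le_left _ _
          have : h * min (Flo c - Δ c) 0 ≤ u * (Flo c - Δ c) := by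
            have hneg : Flo c - Δ c ≤ 0 := by linarith [hΔ c]
            calc h * min (Flo c - Δ c) 0 ≤ h * (Flo c - Δ c) := by nlinarith [hΔ c]
              _ ≤ u * (Flo c - Δ c) := by nlinarith [hu.1, hu.2]
          nlinarith [hu.1, hΔ c]
      linarith
    · have h1 := (hQ y hy c).2
      have h2 := (htest c).2
      have h3 : u * Q y y c ≤ h * max (Fhi c + Δ c) 0 := by
        rcases le_or_gt (Fhi c) 0 with hF | hF
        · have : 0 ≤ h * max (Fhi c + Δ c) 0 := mul_nonneg hh (le_max_right _ _)
          nlinarith [hu.1]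
        · have hpos' : 0 ≤ Fhi c + Δ c := by linarith [hΔ c]
          calc u * Q y y c ≤ u * (Fhi c + Δ c) := by nlinarith [hu.1, hΔ c]
            _ ≤ h * (Fhi c + Δ c) := by nlinarith [hu.2]
            _ ≤ h * max (Fhi c + Δ c) 0 := by nlinarith [le_max_left (Fhi c + Δ c) 0]
      linarith
  obtain ⟨ψ, hψ0, hψ, hψbox⟩ := exists_sol_mem_Icc_of_roughEnclosure Q hx₀ hh henc
  -- (3) Lagrange remainder of the exact solution; bootstrap for the difference
  have htaylor := abs_sub_taylor_le_of_mem_Icc Q hT0 hTs hψ hψbox (p := p) hJ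
  have hdiff := abs_pseudo_sub_sol_le Q hder hψ hψ0 (fun s hs => (hz s hs).1) hψbox
    (fun s hs c => hdist s hs (fun r hr => (hz r ⟨hr.1, hr.2.trans hs.2⟩).1) c) hLm hLip hpos hb
  intro t ht
  refine ⟨(hz t ht).1, fun c => ?_⟩
  have h1 := htaylor t ht c
  have h2 := hdiff t ht c
  rw [hψ0] at h1
  have e : z t c - ∑ k ∈ Finset.range (p + 1), T (z 0) k c * t ^ k
      = (z t c - ψ t c) + (ψ t c - ∑ k ∈ Finset.range (p + 1), T (z 0) k c * t ^ k) := by ring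
  rw [e]
  exact (abs_add_le _ _).trans (by linarith)

end Summit.NavierStokesRegularity.NavierStokesRegularity.Cruxes.RelayFrontStep.PhaseI

end
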